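import Literature.AlgebraicGeometry.Motives.SeesawSemicontinuityKernelRank
import Literature.AlgebraicGeometry.Motives.GrothendieckComplexFieldPoints
import HarnessLib

/-!
# The Grothendieck complex of `𝒪(D)` in degree `0` over an arbitrary integral base, from the
# finite-type case by noetherian approximation (Görtz–Wedhorn II, Thm. 23.133, proof, Step (IV))

`Motives/SeesawSemicontinuityKernelRank` records the named fact `grothendieckComplex_sectionsFibre`
(Görtz–Wedhorn II, Cor. 23.135/23.137 in degree `0` for `(pr_T : X ×_K T → T, 𝒪(D))`, `T` an
arbitrary integral `K`-scheme) and `Motives/GrothendieckComplexFieldPoints` records the two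
inputs of the printed reduction to a noetherian base (Thm. 23.133, proof, Step (IV)):
`grothendieckComplex_sectionsFibre_fieldPoints_ofFiniteType` (Cor. 23.137 in degree `0` over an
integral base of finite type, at all field-valued points) and
`cartierDivisor_prod_noetherianDescent` (locally on `T`, `𝒪(D)` descends to `X ×_K T₀` with `T₀`
of finite type). This file PROVES the reduction
`grothendieckComplex_sectionsFibre_of_fieldPoints_of_descent`: the two facts imply
`grothendieckComplex_sectionsFibre`.

The argument (Step (IV) of the printed proof, "its formation commutes with base change and hence
`F` is its derived pullback under `S → S_λ`", made explicit in degree `0`): given `t₀ ∈ T`, descend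
`D|_{X × V} ∼ (X × φ)^* D₀` on an open piece `j : V ↪ T` around `t₀`, `φ : V → T₀`; take the
matrix `d₀` over an open `V₀ ∋ φ(t₀)` of `T₀` provided by Cor. 23.137 on `T₀`, and put
`V₁ := j(φ⁻¹ V₀)`, `d := φ^* d₀` (transported to `Γ(V₁, 𝒪_T)` through `Γ(V₁, 𝒪_T) ≅ Γ(φ⁻¹V₀, 𝒪_V)`).
For `t ∈ V₁` the canonical point `Spec κ(t) → T` lifts to `τ' : Spec κ(t) → V`, and
`τ := τ' ≫ φ : Spec κ(t) → T₀` is a `κ(t)`-valued point of `T₀` in `V₀` whose fibre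
`X ×_K Spec κ(t)` *is* the fibre `X_t`; functoriality of class pullback
(`CartierDivisor.classPullback_comp_linEquiv`) gives `D_t ∼ (D|_{X×V})_{τ'} ∼ ((X × φ)^*D₀)_{τ'} ∼
(D₀)_τ`, so `Γ(X_t, 𝒪(D_t)) ≅ Γ(X_{κ(t)}, 𝒪((D₀)_τ)) ≅ Ker d₀(τ)` (Cor. 23.137 on `T₀` at the
field-valued point `τ`), and `d₀(τ) = d(t)` because evaluation at field-valued points is natural
(`evalAtFieldPoint_comp`, `evalAtFieldPoint_fromSpecResidueField`).

## References

* U. Görtz, T. Wedhorn, *Algebraic Geometry II: Cohomology of Schemes*, Springer Spektrum (2023),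
  doi:10.1007/978-3-658-43031-3: Thm. 23.133, proof, Step (IV), p. 479; Cor. 23.135, Cor. 23.137,
  p. 480 (read via the held copy). [GortzWedhorn2023]
-/

universe u

open CategoryTheory CategoryTheory.Limits AlgebraicGeometry MonoidalCategory
open CartesianMonoidalCategory
open Literature.AlgebraicGeometry.Motives.RatFn

noncomputable section

namespace Literature.AlgebraicGeometry.Motives

variable {K : Type u} [Field K]

/-- **Linearly equivalent divisors have isomorphic spaces of global sections**
(`CartierDivisor.sectionsEquivOfLinEquiv`, Görtz–Wedhorn I, Prop. 11.28), `Nonempty` form.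
[folklore] -/
theorem CartierDivisor.LinEquiv.nonempty_sectionsEquiv {Y : Scheme.{u}} [IsIntegral Y]
    (L : Type u) [Field L] [Y.Over (Spec (.of L))] {D E : CartierDivisor Y} (h : D.LinEquiv E) :
    Nonempty (D.sections L ≃ₗ[L] E.sections L) := by
  obtain ⟨f, hf, H⟩ := (CartierDivisor.linEquiv_iff D E).1 h
  exact ⟨CartierDivisor.sectionsEquivOfLinEquiv L hf H⟩

/-- **Functoriality of the restriction to fibres**: for `K`-morphisms `f : P → Q`, `g : Q → R` and a
divisor `D` on `X ×_K R`, `(X × (f ≫ g))^* D ∼ (X × f)^* (X × g)^* D` on divisor classes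
(`X ◁ (f ≫ g) = (X ◁ f) ≫ (X ◁ g)` and `CartierDivisor.classPullback_comp_linEquiv`). [folklore] -/
theorem classPullback_whiskerLeft_comp_linEquiv (X : SchemeOver K) {P Q R : SchemeOver K}
    [IsIntegral (X ⊗ P).left] [IsIntegral (X ⊗ Q).left] [IsIntegral (X ⊗ R).left]
    (f : P ⟶ Q) (g : Q ⟶ R) (D : CartierDivisor (X ⊗ R).left) :
    (D.classPullback (X ◁ (f ≫ g)).left).LinEquiv
      ((D.classPullback (X ◁ g).left).classPullback (X ◁ f).left) := by
  have e : (X ◁ (f ≫ g)).left = (X ◁ f).left ≫ (X ◁ g).left := by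
    rw [MonoidalCategory.whiskerLeft_comp]; rfl
  rw [CartierDivisor.classPullback_congr e]
  exact CartierDivisor.classPullback_comp_linEquiv _ _ D

/-- **The Grothendieck complex in degree `0` at a point admitting a descent datum**
(Görtz–Wedhorn II, Thm. 23.133, proof, Step (IV), in degree `0` for `(pr_T, 𝒪(D))`): if around
`t₀ ∈ T` the pair `(T, D)` descends to an integral `K`-scheme `T₀` of finite type (the datum of
`cartierDivisor_prod_noetherianDescent` at `t₀`), then Cor. 23.137 over `T₀` at field-valued
points (`grothendieckComplex_sectionsFibre_fieldPoints_ofFiniteType`) yields the conclusion of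
`grothendieckComplex_sectionsFibre` at `t₀`: an open `V ∋ t₀` and a matrix `d` over `Γ(V, 𝒪_T)`
with `Γ(X_t, 𝒪(D_t)) ≅ Ker d(t)` for all `t ∈ V`. See the module docstring for the argument.
[cite: GortzWedhorn2023, Thm. 23.133, proof, Step (IV) (p. 479), with Cor. 23.135/23.137 (p. 480)] -/
theorem grothendieckComplex_sectionsFibre_at_of_descentData
    (h₁ : grothendieckComplex_sectionsFibre_fieldPoints_ofFiniteType.{u})
    (X T : SchemeOver K) [IsProper X.hom] [GeometricallyIntegral X.hom] [IsIntegral T.left]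
    [IsIntegral (X ⊗ T).left] (D : CartierDivisor (X ⊗ T).left) (t₀ : T.left)
    (hdesc : ∃ (V : SchemeOver K) (j : V ⟶ T) (_ : IsOpenImmersion j.left)
      (_ : t₀ ∈ Set.range j.left) (T₀ : SchemeOver K) (_ : IsIntegral T₀.left)
      (_ : LocallyOfFiniteType T₀.hom) (_ : IsIntegral (X ⊗ V).left) (_ : IsIntegral (X ⊗ T₀).left)
      (φ : V ⟶ T₀) (D₀ : CartierDivisor (X ⊗ T₀).left),
      (D.classPullback (X ◁ j).left).LinEquiv (D₀.classPullback (X ◁ φ).left)) :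
    ∃ (V : T.left.Opens) (_ : t₀ ∈ V) (m n : ℕ) (d : Matrix (Fin n) (Fin m) Γ(T.left, V)),
      ∀ (t : T.left) (ht : t ∈ V),
        letI := fibreOverResidueField X T t
        Nonempty ((D.classPullback (X ◁ residuePtι T t).left).sections (T.left.residueField t)
          ≃ₗ[T.left.residueField t] LinearMap.ker (matrixFibre T.left V d t ht).mulVecLin) := by
  obtain ⟨V, j, hj, ⟨t₀', ht₀'⟩, T₀, hT₀, hT₀', hXV, hXT₀, φ, D₀, hD⟩ := hdesc
  -- Cor. 23.137 on the finite-type base `T₀` at `φ(t₀')`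
  obtain ⟨V₀, hV₀, m, n, d₀, hd₀⟩ := h₁ K X T₀ D₀ (φ.left t₀')
  -- the open piece `V₁ = j(φ⁻¹ V₀)` of `T` and the transported matrix `d = φ^* d₀`
  let W : V.left.Opens := φ.left ⁻¹ᵁ V₀
  let ρ : Γ(T₀.left, V₀) →+* Γ(T.left, j.left ''ᵁ W) :=
    (φ.left.app V₀ ≫ (j.left.appIso W).inv).hom
  refine ⟨j.left ''ᵁ W, ?_, m, n, d₀.map ρ, fun t ht => ?_⟩
  · rw [← ht₀']
    exact (Scheme.Hom.apply_mem_image_iff j.left).2 hV₀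
  · letI := fibreOverResidueField X T t
    -- `t = j(t')` with `t' ∈ φ⁻¹ V₀`
    obtain ⟨t', ht', htt'⟩ : ∃ t', t' ∈ W ∧ j.left t' = t := by exact ht
    -- lift `Spec κ(t) → T` to `τ' : Spec κ(t) → V`
    have hrange : Set.range (T.left.fromSpecResidueField t) ⊆ Set.range j.left := by
      rw [Scheme.range_fromSpecResidueField]
      exact Set.singleton_subset_iff.2 ⟨t', htt'⟩
    let τ' : Spec (T.left.residueField t) ⟶ V.left :=
      IsOpenImmersion.lift j.left (T.left.fromSpecResidueField t) hrange
    have hτ' : τ' ≫ j.left = T.left.fromSpecResidueField t := IsOpenImmersion.lift_fac _ _ _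
    have hpt : τ' (IsLocalRing.closedPoint (T.left.residueField t)) = t' := by
      apply j.left.isOpenEmbedding.injective
      rw [← Scheme.Hom.comp_apply, hτ', Scheme.fromSpecResidueField_apply, htt']
    -- as `K`-morphisms: `ι : Spec κ(t) → V` with `ι ≫ j = residuePtι T t`, and `τ := ι ≫ φ`
    let ι : residuePt T t ⟶ V := Over.homMk τ' (by
      have h' := congrArg (· ≫ T.hom) hτ'
      simp only [Category.assoc, Over.w] at h'
      exact h')
    have hι : ι ≫ j = residuePtι T t := Over.OverMorphism.ext hτ'
    have hτ : (ι ≫ φ).left (IsLocalRing.closedPoint (T.left.residueField t)) ∈ V₀ := by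
      change φ.left (τ' (IsLocalRing.closedPoint (T.left.residueField t))) ∈ V₀
      rw [hpt]
      exact ht'
    -- Cor. 23.137 at the `κ(t)`-valued point `ι ≫ φ` of `T₀`: its fibre is `X_t` on the nose
    obtain ⟨e⟩ := hd₀ (T.left.residueField t) (residuePt T t).hom (ι ≫ φ) hτ
    -- `D_t ∼ (D₀)_{ι ≫ φ}` on `X_t`
    have hlin : (D.classPullback (X ◁ residuePtι T t).left).LinEquiv
        (D₀.classPullback (X ◁ (ι ≫ φ)).left) := by
      rw [← hι]
      exact ((classPullback_whiskerLeft_comp_linEquiv X ι j D).trans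
        (hD.classPullback (X ◁ ι).left)).trans
        (classPullback_whiskerLeft_comp_linEquiv X ι φ D₀).symm
    obtain ⟨e₁⟩ := hlin.nonempty_sectionsEquiv (T.left.residueField t)
    -- `d(t) = d₀(ι ≫ φ)`: naturality of evaluation at field-valued points
    have hev : ∀ a : Γ(T₀.left, V₀), T.left.evaluation (j.left ''ᵁ W) t ht (ρ a) =
        evalAtFieldPoint (ι ≫ φ).left V₀ hτ a := by
      intro a
      have hW : τ' (IsLocalRing.closedPoint (T.left.residueField t)) ∈ W := by
        rw [hpt]; exact ht'
      -- right-hand side: `d₀(τ' ≫ φ) = (φ^* d₀)(τ')`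
      have e2 : evalAtFieldPoint (ι ≫ φ).left V₀ hτ a =
          evalAtFieldPoint τ' W hW (φ.left.app V₀ a) :=
        evalAtFieldPoint_comp τ' φ.left V₀ hτ a
      -- left-hand side: evaluation at `t` is evaluation at `Spec κ(t) → T = τ' ≫ j`
      have h1 : (T.left.fromSpecResidueField t)
          (IsLocalRing.closedPoint (T.left.residueField t)) ∈ j.left ''ᵁ W := by
        rwa [Scheme.fromSpecResidueField_apply]
      have h2 : (τ' ≫ j.left) (IsLocalRing.closedPoint (T.left.residueField t)) ∈ j.left ''ᵁ W := by
        rwa [hτ']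
      have e1 : T.left.evaluation (j.left ''ᵁ W) t ht (ρ a) =
          evalAtFieldPoint τ' (j.left ⁻¹ᵁ j.left ''ᵁ W) h2 (j.left.app (j.left ''ᵁ W) (ρ a)) := by
        rw [← evalAtFieldPoint_fromSpecResidueField t (j.left ''ᵁ W) ht h1 (ρ a),
          evalAtFieldPoint_congr hτ'.symm (j.left ''ᵁ W) h1 h2]
        exact evalAtFieldPoint_comp τ' j.left (j.left ''ᵁ W) h2 (ρ a)
      -- and `j^*` undoes the transport `Γ(φ⁻¹V₀, 𝒪_V) ≅ Γ(j(φ⁻¹V₀), 𝒪_T)`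
      have e3 : j.left.app (j.left ''ᵁ W) (ρ a) =
          V.left.presheaf.map (homOfLE (j.left.preimage_image_eq W).le).op (φ.left.app V₀ a) := by
        change (φ.left.app V₀ ≫ (j.left.appIso W).inv ≫ j.left.app (j.left ''ᵁ W)) a = _
        rw [Scheme.Hom.appIso_inv_app]
        rfl
      rw [e1, e3, evalAtFieldPoint_map τ' (j.left.preimage_image_eq W).le h2 (φ.left.app V₀ a), e2]
    have hmat : matrixFibre T.left (j.left ''ᵁ W) (d₀.map ρ) t ht =
        d₀.map (evalAtFieldPoint (ι ≫ φ).left V₀ hτ) := by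
      simp only [matrixFibre, Matrix.map_map]
      congr 1
      funext a
      exact hev a
    exact ⟨e₁.trans (e.trans (LinearEquiv.ofEq _ _ (congrArg
      (fun M : Matrix (Fin n) (Fin m) (T.left.residueField t) => LinearMap.ker M.mulVecLin)
      hmat.symm)))⟩

/-- **`grothendieckComplex_sectionsFibre` from the finite-type case and noetherian descent**
(Görtz–Wedhorn II, Thm. 23.133, proof, Step (IV)): the named fact
`grothendieckComplex_sectionsFibre` of `Motives/SeesawSemicontinuityKernelRank` follows from
`grothendieckComplex_sectionsFibre_fieldPoints_ofFiniteType` (Cor. 23.137 over a base of finite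
type, field-valued points) and `cartierDivisor_prod_noetherianDescent` (descent of `𝒪(D)` to a
base of finite type, locally on `T`).
[cite: GortzWedhorn2023, Thm. 23.133, proof, Step (IV) (p. 479), with Cor. 23.135/23.137 (p. 480)] -/
theorem grothendieckComplex_sectionsFibre_of_fieldPoints_of_descent
    (h₁ : grothendieckComplex_sectionsFibre_fieldPoints_ofFiniteType.{u})
    (h₂ : cartierDivisor_prod_noetherianDescent.{u}) :
    grothendieckComplex_sectionsFibre.{u} :=
  fun K _ X T _ _ _ _ D t₀ =>
    grothendieckComplex_sectionsFibre_at_of_descentData h₁ X T D t₀ (h₂ K X T D t₀)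

/-- **Over a base of finite type no descent is needed**: for `T` integral and locally of finite
type over `K`, the descent datum is the identity (`V = T₀ = T`, `D₀ = D`), so
`grothendieckComplex_sectionsFibre_fieldPoints_ofFiniteType` alone (Cor. 23.137) gives the
conclusion of `grothendieckComplex_sectionsFibre` at every point of `T` (the case of the
seesaw theorem for varieties `T`).
[cite: GortzWedhorn2023, Cor. 23.137 (p. 480) with (23.28.5) (p. 482)] -/
theorem grothendieckComplex_sectionsFibre_at_of_locallyOfFiniteType
    (h₁ : grothendieckComplex_sectionsFibre_fieldPoints_ofFiniteType.{u})
    (X T : SchemeOver K) [IsProper X.hom] [GeometricallyIntegral X.hom] [IsIntegral T.left]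
    [LocallyOfFiniteType T.hom] [IsIntegral (X ⊗ T).left] (D : CartierDivisor (X ⊗ T).left)
    (t₀ : T.left) :
    ∃ (V : T.left.Opens) (_ : t₀ ∈ V) (m n : ℕ) (d : Matrix (Fin n) (Fin m) Γ(T.left, V)),
      ∀ (t : T.left) (ht : t ∈ V),
        letI := fibreOverResidueField X T t
        Nonempty ((D.classPullback (X ◁ residuePtι T t).left).sections (T.left.residueField t)
          ≃ₗ[T.left.residueField t] LinearMap.ker (matrixFibre T.left V d t ht).mulVecLin) :=
  grothendieckComplex_sectionsFibre_at_of_descentData h₁ X T D t₀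
    ⟨T, 𝟙 T, inferInstanceAs (IsOpenImmersion (𝟙 T.left)), ⟨t₀, rfl⟩, T, inferInstance,
      inferInstance, inferInstance, inferInstance, 𝟙 T, D, CartierDivisor.LinEquiv.refl _⟩

end Literature.AlgebraicGeometry.Motives

end
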